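import Summits.HodgeConjecture.CorCM.Census.CyclicCharacterNonrootPrepK

/-!
# Cyclic characters, XLVII: EVEN KERNEL, `d = 0` — THE INTERVAL-RULED CERTIFICATE for every `k ≥ 2`

COR-CM (cell `pub-hodgecm2`), count-neutral kernel combinatorics by the binder seat b09 (gen 44; lane CYCLIC-CHARACTER FIBRE LAW, part XLVII), on parts
XLI–XLVI, gen 43ʼs even three-across (`Census/CyclicCharacterEvenEquator.zeta_mem_of_threeAcross_even_up`), vertical faces
(`Census/CyclicCharacterEvenSpectator.unitShift_mem_of_upperVertical`), adjacent ties (`Census/CyclicCharacterEvenTiePairs.exists_adjacent_tie_blk_ne`),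
near blocks (`Census/CyclicCharacterEvenNearBlocks`), gen 38/39ʼs covering on a set (`Census/BaseBlockCoveringOn`) and lit-andre-3ʼs fixed types
(`Census/TypeStabiliserSubgroup.exists_rt_eq_of_notMem_zpowers`) BY NAME.  Theorems only (no definition, no `decide`, no certificate data, no named fact,
no `sorry`).  HONEST FRAMING: `HC_CM` is NOT proved, here or anywhere in the tree; nothing here is a period or a headline.

**THE CERTIFICATE (`exists_nonrootCertK`).**  `G` finite, `c` a central involution, `w : G ↠ ℤ/2ᵏ` (`k ≥ 2`) additive with `w c ≠ 0`, kernel of even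
size `2m ≥ 4`, and `d = 0` (some `g` with `w g` odd has `c ∉ ⟨g⟩`).  There is a face family `S₀` with `|S₀| + 2 ≤ β(G, c)` (`= φ₂ + 2`) such that
`L = ℤ⟨pairs⟩ + ℤ[G]·S₀` (i) has the toward property through every type of potential `≥ 2`, (ii) contains `ζ_t` for a bottom point `t`, (iii) contains the
relation `R(B')` for a set `B'` of bottom points, and (iv) contains a unit arc shift at every interior position `1 ≤ j ≤ 2ᵏ⁻¹ − 2`.  CONSTRUCTION: `Ψ` a type
fixed by a non-root `g` with `w g = 1` (balanced: `x_j(Ψ) = m` for all `j`), `B = F_0 ∖ Ψ`, `X_B` the pure tie below it, `X'' = X_B^{(b)(v)}` an adjacent tie in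
another block; `S₀` = the cover of the far blocks that are neither interval ties nor the block of `Ψ` + the INTERVAL-RULED family on the interval-tie blocks other
than `E = blk X''` (part XLII) + the UP face `gface X'' u u'` + the owned face `gface Ψ s t'` (`s ∈ F_0 ∩ Ψ`, `t' ∈ F_{h−1} ∖ Ψ`) + the three-across face
`gface X_B^{(b)} b v` + the vertical faces `gface X_B v u_j` (`w u_j = j`, `1 ≤ j ≤ h − 2`).  Then (i) by transport of the explicit faces; (ii) by the
three-across with `X_B` DOWN (part XLIII) and `X''` UP; (iv) by gen 43ʼs vertical faces with the spectator ties DOWN (parts XLIII, XLVI); (iii) by part XLV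
with all unit shifts (part XLVI).  Part XLVIII reads off the law `μ = φ₂ = β − 2` for every `k ≥ 2`.

## References
* [Pohlmann1968] H. Pohlmann, Algebraic cycles on abelian varieties of complex multiplication type, Ann. of Math. 88 (1968), Thm 1.
-/

namespace Summit.HodgeConjecture.CorCM.Census.CyclicCharacter

open Finset
open Summit.HodgeConjecture.CorCM.Prior.AllgGroup.RfwfAllgGroup
open Summit.HodgeConjecture.CorCM.Census.BlockParity
open Summit.HodgeConjecture.CorCM.Census.Coinvariant
open Summit.HodgeConjecture.CorCM.Census.TwistGeneration
open Summit.HodgeConjecture.CorCM.Census.BaseBlock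
open Summit.HodgeConjecture.CorCM.Census.TypeStabiliser

noncomputable section

variable {G : Type*} [Group G] [Fintype G] [DecidableEq G] {k : ℕ} {w : G → ZMod (2 ^ k)} {c : G}

/-- **THE INTERVAL-RULED CERTIFICATE for `d = 0`, every `k ≥ 2`** (see the file header). [folklore] -/
theorem exists_nonrootCertK [Fintype (CMF G c)] (hw : ∀ P Q : G, w (P * Q) = w P + w Q) (hk : 1 ≤ k) (hk2 : 2 ≤ k)
    (hc2 : c * c = 1) (hcen : ∀ x : G, x * c = c * x) (hwc : w c ≠ 0) (h1 : ∃ g₁ : G, w g₁ = 1)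
    (hnon : ∃ g : G, ¬ 2 ∣ (w g).val ∧ c ∉ Subgroup.zpowers g)
    {m : ℕ} (hm : 2 * m = (univ.filter fun s : G => w s = 0).card) (hm2 : 2 ≤ m) :
    ∃ S₀ : Finset (CMF G c →₀ ℤ), (↑S₀ ⊆ gfaceSet G c hc2) ∧ S₀.card + 2 ≤ Fintype.card (Block c) ∧
      (∀ Φ : CMF G c, 2 ≤ bpot c (arcType hw hk hc2 hwc 0) Φ → ∃ Q s s' : G,
        bpot c (arcType hw hk hc2 hwc 0) Φ = ddist (rt c Q (arcType hw hk hc2 hwc 0)) Φ ∧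
          s ∈ (rt c Q (arcType hw hk hc2 hwc 0)).1 \ Φ.1 ∧ s' ∈ (rt c Q (arcType hw hk hc2 hwc 0)).1 \ Φ.1 ∧ s ≠ s' ∧
            gface c hc2 Φ s s' ∈ Submodule.span ℤ (pairSet c) ⊔ Submodule.span ℤ (translates c S₀)) ∧
      (∃ t : G, w t = 0 ∧
        (Finsupp.single (oflipCM c hc2 t (arcType hw hk hc2 hwc 0)) (1 : ℤ) - Finsupp.single (arcType hw hk hc2 hwc 0) 1) +
          (Finsupp.single (oflipCM c hc2 t (arcType hw hk hc2 hwc 1)) (1 : ℤ) - Finsupp.single (arcType hw hk hc2 hwc 1) 1) ∈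
            Submodule.span ℤ (pairSet c) ⊔ Submodule.span ℤ (translates c S₀)) ∧
      (∃ B' : Finset G, B' ⊆ (univ.filter fun s : G => w s = 0) ∧
        Finsupp.single (arcType hw hk hc2 hwc 0) (1 : ℤ) - Finsupp.single (arcType hw hk hc2 hwc 1) 1 +
            (∑ q ∈ B', (Finsupp.single (oflipCM c hc2 q (arcType hw hk hc2 hwc 0)) (1 : ℤ) - Finsupp.single (arcType hw hk hc2 hwc 0) 1)) -
            (∑ q ∈ (univ.filter fun s : G => w s = 0) \ B',
              (Finsupp.single (oflipCM c hc2 q (arcType hw hk hc2 hwc 1)) (1 : ℤ) - Finsupp.single (arcType hw hk hc2 hwc 1) 1)) ∈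
          Submodule.span ℤ (pairSet c) ⊔ Submodule.span ℤ (translates c S₀)) ∧
      (∀ j : ℕ, 1 ≤ j → j ≤ 2 ^ (k - 1) - 2 → ∃ u₀ : G, w u₀ = (j : ZMod (2 ^ k)) ∧
        (Finsupp.single (oflipCM c hc2 u₀ (arcType hw hk hc2 hwc 0)) (1 : ℤ) - Finsupp.single (arcType hw hk hc2 hwc 0) 1) -
          (Finsupp.single (oflipCM c hc2 u₀ (arcType hw hk hc2 hwc 1)) (1 : ℤ) - Finsupp.single (arcType hw hk hc2 hwc 1) 1) ∈
            Submodule.span ℤ (pairSet c) ⊔ Submodule.span ℤ (translates c S₀)) := by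
  classical
  have hmn : m < (univ.filter fun s : G => w s = 0).card := by omega
  have hm1 : 1 ≤ m := by omega
  haveI : Fact (1 < 2 ^ k) := ⟨Nat.one_lt_two_pow (by omega)⟩
  have hh2 : 2 ≤ 2 ^ (k - 1) := le_trans (pow_one 2).symm.le (Nat.pow_le_pow_right (by norm_num) (by omega))
  have hhk : 2 ^ (k - 1) < 2 ^ k := Nat.pow_lt_pow_right (by norm_num) (by omega)
  have h4k : 4 ≤ 2 ^ k := by have := Nat.pow_le_pow_right (show 0 < 2 by norm_num) hk2; simpa using this
  have hcast : ∀ a b : ℕ, a < 2 ^ k → b < 2 ^ k → (a : ZMod (2 ^ k)) = (b : ZMod (2 ^ k)) → a = b := fun a b ha hb e => by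
    have := (ZMod.natCast_eq_natCast_iff' a b (2 ^ k)).mp e
    rwa [Nat.mod_eq_of_lt ha, Nat.mod_eq_of_lt hb] at this
  obtain ⟨Qm, hQm⟩ := exists_apply_eq hw h1 (-1)
  have eT₁ : arcType hw hk hc2 hwc 1 = rt c Qm (arcType hw hk hc2 hwc 0) := arcType_eq_rt hw hk hc2 hwc hQm
  have hwc' : ∀ x : G, w x = 0 → ∀ y : G, w y = 0 → y ≠ c * x := fun x hx y hy h => hwc (by
    have := congrArg w h; rw [hw, hx, hy, add_zero] at this; exact this.symm)
  -- the non-root, the balanced type, its bottom deviation `B = F_0 ∖ Ψ` and the pure tie `X = X_B`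
  obtain ⟨g, hg, hgc⟩ := exists_apply_eq_one_notMem_zpowers_gen hw hnon
  obtain ⟨Ψ, hΨ⟩ := exists_rt_eq_of_notMem_zpowers c hc2 hcen hgc
  have hBm : ((univ.filter fun s : G => w s = 0) \ Ψ.1).card = m := card_fib_sdiff_eq_of_rt_eq hw hk hc2 hwc h1 hm hΨ hg 0
  obtain ⟨-, hpotΨ2⟩ := bpot_of_rt_eq hw hk hc2 hwc h1 hm hm2 hΨ hg
  have hBF : (univ.filter fun s : G => w s = 0) \ Ψ.1 ⊆ univ.filter fun s : G => w s = 0 := sdiff_subset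
  have hB2 : 2 * ((univ.filter fun s : G => w s = 0) \ Ψ.1).card = (univ.filter fun s : G => w s = 0).card := by rw [hBm]; exact hm
  obtain ⟨X, hX⟩ := exists_sdiff_eq_of_subset_fibre hw hk hc2 hwc _ hBF
  obtain ⟨b, hb, v, hv, hblkne⟩ := exists_adjacent_tie_blk_ne hw hk hk2 hc2 hwc h1 hBF hB2 (by omega) hX
  have hb0 : w b = 0 := (mem_filter.mp (hBF hb)).2
  have hv0 : w v = 0 := (mem_filter.mp (mem_sdiff.mp hv).1).2
  have hvB : v ∉ (univ.filter fun s : G => w s = 0) \ Ψ.1 := (mem_sdiff.mp hv).2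
  have hbv : b ≠ v := fun h => hvB (h ▸ hb)
  have hbT : b ∈ (arcType hw hk hc2 hwc 0).1 := (mem_arcType_zero_and_notMem_one hw hk hc2 hwc hb0).1
  have hbX : b ∉ X.1 := fun h => (mem_sdiff.mp (hX.symm ▸ hb : b ∈ (arcType hw hk hc2 hwc 0).1 \ X.1)).2 h
  have hX' : (arcType hw hk hc2 hwc 0).1 \ (oflipCM c hc2 b X).1 = ((univ.filter fun s : G => w s = 0) \ Ψ.1).erase b := by
    rw [dev_oflip c hc2 hbT hbX, hX]
  have hX'b : oflipCM c hc2 b (oflipCM c hc2 b X) = X := oflipCM_oflipCM_self c hc2 b X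
  have hX'' : (arcType hw hk hc2 hwc 0).1 \ (oflipCM c hc2 v (oflipCM c hc2 b X)).1 = insert v (((univ.filter fun s : G => w s = 0) \ Ψ.1).erase b) :=
    sdiff_oflipCM_eq_insert hw hk hc2 hwc hX' hv0 (fun h => hvB (mem_of_mem_erase h))
  have hCv : insert v (((univ.filter fun s : G => w s = 0) \ Ψ.1).erase b) ⊆ univ.filter fun s : G => w s = 0 :=
    insert_subset (mem_sdiff.mp hv).1 ((erase_subset b _).trans hBF)
  have hcv : (insert v (((univ.filter fun s : G => w s = 0) \ Ψ.1).erase b)).card = m := by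
    rw [card_insert_of_notMem (fun h => hvB (mem_of_mem_erase h)), card_erase_add_one hb, hBm]
  have h2X'' : 2 * ((arcType hw hk hc2 hwc 0).1 \ (oflipCM c hc2 v (oflipCM c hc2 b X)).1).card = (univ.filter fun s : G => w s = 0).card := by
    rw [hX'', hcv]; exact hm
  have hpotX'' : bpot c (arcType hw hk hc2 hwc 0) (oflipCM c hc2 v (oflipCM c hc2 b X)) = m := by
    rw [bpot_eq_of_tie hw hk hc2 hwc h2X'', hX'', hcv]
  have hne : blk c (oflipCM c hc2 v (oflipCM c hc2 b X)) ≠ blk c X := hblkne _ hX''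
  obtain ⟨E, hEdef⟩ : ∃ E : Block c, E = blk c (oflipCM c hc2 v (oflipCM c hc2 b X)) := ⟨_, rfl⟩
  have hT1X'' := sdiff_arcType_one_eq_image hw hk hc2 hwc (oflipCM c hc2 v (oflipCM c hc2 b X)) (hX''.symm ▸ hCv)
  rw [hX''] at hT1X''
  have hUc : ((univ.filter fun s : G => w s = 0) \ insert v (((univ.filter fun s : G => w s = 0) \ Ψ.1).erase b)).card = m := by
    have := card_sdiff_add_card_eq_card hCv; omega
  have hd1X'' : ddist (arcType hw hk hc2 hwc 1) (oflipCM c hc2 v (oflipCM c hc2 b X)) = m := by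
    unfold ddist; rw [hT1X'', card_image_of_injective _ (mul_right_injective c), hUc]
  -- the explicit UP face at `X''`
  obtain ⟨u, hu, u', hu', huu'⟩ := one_lt_card.mp (by omega : 1 < ((univ.filter fun s : G => w s = 0) \
    insert v (((univ.filter fun s : G => w s = 0) \ Ψ.1).erase b)).card)
  have hu0 : w u = 0 := (mem_filter.mp (mem_sdiff.mp hu).1).2
  have hu'0 : w u' = 0 := (mem_filter.mp (mem_sdiff.mp hu').1).2
  have hfUp : gface c hc2 (oflipCM c hc2 v (oflipCM c hc2 b X)) u u' ∈ gfaceSet G c hc2 :=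
    ⟨_, u, u', by rw [mem_orb]; push Not; exact ⟨huu'.symm, hwc' u hu0 u' hu'0⟩, rfl⟩
  have hfUpeq : gface c hc2 (oflipCM c hc2 v (oflipCM c hc2 b X)) u u' = gface c hc2 (oflipCM c hc2 v (oflipCM c hc2 b X)) (c * u) (c * u') := by
    simp only [gface, oflipCM_cmul]
  -- the owned face at `Ψ`: `t' ∈ F_{h−1} ∖ Ψ`, `s ∈ F_0 ∩ Ψ`
  have hVm : ((univ.filter fun s : G => w s = ((2 ^ (k - 1) - 1 : ℕ) : ZMod (2 ^ k))) \ Ψ.1).card = m :=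
    card_fib_sdiff_eq_of_rt_eq hw hk hc2 hwc h1 hm hΨ hg _
  obtain ⟨t', ht'⟩ : (((univ.filter fun s : G => w s = ((2 ^ (k - 1) - 1 : ℕ) : ZMod (2 ^ k))) \ Ψ.1)).Nonempty := card_pos.mp (by omega)
  have ht'1 : w t' = ((2 ^ (k - 1) - 1 : ℕ) : ZMod (2 ^ k)) := (mem_filter.mp (mem_sdiff.mp ht').1).2
  have ht'Ψ : t' ∉ Ψ.1 := (mem_sdiff.mp ht').2
  have hIc : ((univ.filter fun s : G => w s = 0) \ ((univ.filter fun s : G => w s = 0) \ Ψ.1)).card = m := by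
    have := card_sdiff_add_card_eq_card hBF; omega
  obtain ⟨s, hs⟩ : ((univ.filter fun s : G => w s = 0) \ ((univ.filter fun s : G => w s = 0) \ Ψ.1)).Nonempty := card_pos.mp (by omega)
  have hs0 : w s = 0 := (mem_filter.mp (mem_sdiff.mp hs).1).2
  have hsΨ : s ∈ Ψ.1 := by by_contra h; exact (mem_sdiff.mp hs).2 (mem_sdiff.mpr ⟨(mem_sdiff.mp hs).1, h⟩)
  have hcs : w (c * s) = ((2 ^ (k - 1) : ℕ) : ZMod (2 ^ k)) := by rw [hw, hs0, add_zero, apply_c hw hk hc2 hwc]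
  have hcsΨ : c * s ∉ Ψ.1 := fun h => ((cmul_mem_iff Ψ s).mp h) hsΨ
  have hst' : c * s ≠ t' := fun h => by
    have := congrArg w h; rw [ht'1, hcs] at this; have := hcast _ _ hhk (by omega) this; omega
  have hfΨ : gface c hc2 Ψ s t' ∈ gfaceSet G c hc2 := by
    refine ⟨Ψ, s, t', ?_, rfl⟩
    rw [mem_orb]; push Not
    refine ⟨fun h => ?_, fun h => hst' h.symm⟩
    have := congrArg w h; rw [ht'1, hs0] at this; exact natCast_ne_zero_of_lt (by omega) (by omega) this
  have hfΨeq : gface c hc2 Ψ s t' = gface c hc2 Ψ (c * s) t' := by simp only [gface, oflipCM_cmul]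
  -- the three-across face
  have hf3 : gface c hc2 (oflipCM c hc2 b X) b v ∈ gfaceSet G c hc2 :=
    ⟨oflipCM c hc2 b X, b, v, by rw [mem_orb]; push Not; exact ⟨hbv.symm, hwc' b hb0 v hv0⟩, rfl⟩
  -- the vertical faces `gface X_B v u_j`
  have hpt : ∀ j : ℕ, ∃ u : G, w u = (j : ZMod (2 ^ k)) := fun j => exists_apply_eq hw h1 _
  choose pt hpt using hpt
  have hcv' : w (c * v) = ((2 ^ (k - 1) : ℕ) : ZMod (2 ^ k)) := by rw [hw, hv0, add_zero, apply_c hw hk hc2 hwc]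
  have hptorb : ∀ j : ℕ, 1 ≤ j → j ≤ 2 ^ (k - 1) - 2 → pt j ∉ orb c v := by
    intro j hj1 hj2
    rw [mem_orb]; push Not
    refine ⟨fun h => ?_, fun h => ?_⟩
    · have := congrArg w h; rw [hpt, hv0] at this; exact natCast_ne_zero_of_lt hj1 (by omega) this
    · have := congrArg w h; rw [hpt, hcv'] at this; have := hcast _ _ (by omega) hhk this; omega
  set Gs : Finset (CMF G c →₀ ℤ) := (Icc 1 (2 ^ (k - 1) - 2)).image (fun j => gface c hc2 X v (pt j)) with hGs
  -- the interval-tie predicate, the interval-ruled family, the cover of the remaining far blocks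
  obtain ⟨tie, htie⟩ : ∃ tie : Block c → Prop, ∀ Bk : Block c, tie Bk ↔ (2 ≤ bpot c (arcType hw hk hc2 hwc 0) Bk.out ∧
      ∃ (Q : G) (r : ℕ), r + 1 < 2 ^ k ∧ ∀ P : G, bpot c (arcType hw hk hc2 hwc 0) Bk.out = ddist (rt c P (arcType hw hk hc2 hwc 0)) Bk.out ↔
        ∃ i : ℕ, i ≤ r ∧ w P = w Q - (i : ZMod (2 ^ k))) := ⟨_, fun Bk => Iff.rfl⟩
  haveI htiedec : DecidablePred tie := fun _ => Classical.propDecidable _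
  obtain ⟨St, hStf, hStc, hSt⟩ := exists_intervalRuled hw hk hc2 hwc h1 tie htie E
  obtain ⟨Sc, hScf, hScc, -, -, -, htwc⟩ := exists_joint_cover_on c (arcType hw hk hc2 hwc 0) hc2
    (fun Bk : Block c => 2 ≤ bpot c (arcType hw hk hc2 hwc 0) Bk.out ∧ ¬ tie Bk ∧ Bk ≠ blk c Ψ) (fun _ h => h.1) ∅
    (by rw [Finset.coe_empty]; exact linearIndepOn_empty _ _) (fun f hf => absurd hf (Finset.notMem_empty f))
  set S₀ : Finset (CMF G c →₀ ℤ) := ((Sc ∪ St) ∪ {gface c hc2 (oflipCM c hc2 v (oflipCM c hc2 b X)) u u', gface c hc2 Ψ s t',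
    gface c hc2 (oflipCM c hc2 b X) b v}) ∪ Gs with hS₀
  have hS₀f : (↑S₀ : Set (CMF G c →₀ ℤ)) ⊆ gfaceSet G c hc2 := by
    intro f hf
    rw [hS₀, coe_union, Set.mem_union] at hf
    rcases hf with hf | hf
    · rw [coe_union, Set.mem_union] at hf
      rcases hf with hf | hf
      · rw [coe_union, Set.mem_union] at hf
        rcases hf with hf | hf; exacts [hScf hf, hStf hf]
      · simp only [coe_insert, coe_singleton, Set.mem_insert_iff, Set.mem_singleton_iff] at hf
        rcases hf with rfl | rfl | rfl; exacts [hfUp, hfΨ, hf3]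
    · rw [hGs, coe_image] at hf
      obtain ⟨j, hj, rfl⟩ := hf
      rw [coe_Icc, Set.mem_Icc] at hj
      exact ⟨X, v, pt j, hptorb j hj.1 hj.2, rfl⟩
  set L := Submodule.span ℤ (pairSet c) ⊔ Submodule.span ℤ (translates c S₀) with hLdef
  have hScS : Sc ⊆ S₀ := subset_union_left.trans (subset_union_left.trans subset_union_left)
  have hStS : St ⊆ S₀ := subset_union_right.trans (subset_union_left.trans subset_union_left)
  have hUpS : gface c hc2 (oflipCM c hc2 v (oflipCM c hc2 b X)) u u' ∈ S₀ := by
    rw [hS₀]; exact mem_union_left _ (mem_union_right _ (mem_insert_self _ _))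
  have hΨS : gface c hc2 Ψ s t' ∈ S₀ := by rw [hS₀]; exact mem_union_left _ (mem_union_right _ (mem_insert_of_mem (mem_insert_self _ _)))
  have h3S : gface c hc2 (oflipCM c hc2 b X) b v ∈ S₀ := by
    rw [hS₀]; exact mem_union_left _ (mem_union_right _ (mem_insert_of_mem (mem_insert_of_mem (mem_singleton_self _))))
  have hGsS : ∀ j : ℕ, 1 ≤ j → j ≤ 2 ^ (k - 1) - 2 → gface c hc2 X v (pt j) ∈ S₀ := fun j hj1 hj2 => by
    rw [hS₀, hGs]; exact mem_union_right _ (mem_image_of_mem _ (mem_Icc.mpr ⟨hj1, hj2⟩))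
  have hsub : ∀ S' : Finset (CMF G c →₀ ℤ), S' ⊆ S₀ → Submodule.span ℤ (translates c S') ≤ L := fun S' hS' =>
    (Submodule.span_mono fun y hy => by obtain ⟨Q', f, hf, e⟩ := hy; exact ⟨Q', f, hS' hf, e⟩).trans le_sup_right
  have hLQ : ∀ f ∈ S₀, ∀ Q' : G, Finsupp.mapDomain (rt c Q') f ∈ L := fun f hf Q' => Submodule.mem_sup_right (Submodule.subset_span ⟨Q', _, hf, rfl⟩)
  have hL : ∀ f ∈ S₀, f ∈ L := fun f hf => Submodule.mem_sup_right (mem_span_translates_of_mem c S₀ hf)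
  obtain ⟨htwt, hrule⟩ := hSt L (hsub St hStS)
  -- (i) the toward property
  have hcsT : c * s ∈ (rt c Qm (arcType hw hk hc2 hwc 0)).1 \ Ψ.1 := by
    rw [← eT₁]
    refine mem_sdiff.mpr ⟨(mem_arcType_iff_exists hw hk hc2 hwc 1 _).mpr ⟨2 ^ (k - 1) - 1, by omega, ?_⟩, hcsΨ⟩
    rw [hcs, natCast_half_sub_one]; ring
  have ht'T : t' ∈ (rt c Qm (arcType hw hk hc2 hwc 0)).1 \ Ψ.1 := by
    rw [← eT₁]
    refine mem_sdiff.mpr ⟨(mem_arcType_iff_exists hw hk hc2 hwc 1 _).mpr ⟨2 ^ (k - 1) - 2, by omega, ?_⟩, ht'Ψ⟩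
    rw [ht'1, show 2 ^ (k - 1) - 1 = 2 ^ (k - 1) - 2 + 1 from by omega, Nat.cast_add, Nat.cast_one, add_comm]
  have htw : ∀ Φ : CMF G c, 2 ≤ bpot c (arcType hw hk hc2 hwc 0) Φ → ∃ Q s s' : G, bpot c (arcType hw hk hc2 hwc 0) Φ = ddist (rt c Q (arcType hw hk hc2 hwc 0)) Φ ∧
      s ∈ (rt c Q (arcType hw hk hc2 hwc 0)).1 \ Φ.1 ∧ s' ∈ (rt c Q (arcType hw hk hc2 hwc 0)).1 \ Φ.1 ∧ s ≠ s' ∧ gface c hc2 Φ s s' ∈ L := by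
    refine toward_all_of_on c (arcType hw hk hc2 hwc 0) hc2
      (fun Bk : Block c => 2 ≤ bpot c (arcType hw hk hc2 hwc 0) Bk.out ∧ ¬ tie Bk ∧ Bk ≠ blk c Ψ) _ (fun Φ hΦ => htwc _ (hsub Sc hScS) Φ hΦ) ?_
    intro Φ hΦ hnot
    by_cases htieΦ : tie (blk c Φ)
    · by_cases hE : blk c Φ = E
      · -- the explicit UP face, presented through `T_1 = T_0·Qm⁻¹`
        refine toward_of_explicit c (arcType hw hk hc2 hwc 0) hc2 _ (Q₀ := Qm) (t := c * u) (t' := c * u')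
          (by rw [← eT₁, hpotX'', hd1X'']) (by rw [← eT₁, hT1X'']; exact mem_image_of_mem _ hu) (by rw [← eT₁, hT1X'']; exact mem_image_of_mem _ hu')
          (fun h => huu' (mul_left_cancel h)) (fun Q' => by rw [← hfUpeq]; exact hLQ _ hUpS Q') (hE.trans hEdef)
      · exact htwt Φ htieΦ hE
    · have hblk : blk c Φ = blk c Ψ := by
        by_contra h; exact hnot ⟨by rw [bpot_out]; exact hΦ, htieΦ, h⟩
      exact toward_of_explicit c (arcType hw hk hc2 hwc 0) hc2 _ (Q₀ := Qm) (t := c * s) (t' := t')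
        (bpot_eq_ddist_of_blk_eq_balanced hw hk hc2 hwc h1 hm hΨ hg (Z := Ψ) rfl Qm) hcsT ht'T hst'
        (fun Q' => by rw [← hfΨeq]; exact hLQ _ hΨS Q') hblk
  -- the excluded block misses the sub-lattices of the sub-balanced types above `B`
  have hEof : ∀ Y : CMF G c, (∀ P ∈ (arcType hw hk hc2 hwc 0).1 \ Y.1, w P = 0 → P ∈ (univ.filter fun s : G => w s = 0) \ Ψ.1) →
      (∀ i : ℕ, i < 2 ^ (k - 1) → ((univ.filter fun s : G => w s = (i : ZMod (2 ^ k))) \ Y.1).card ≤ m) →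
      ∀ Z : CMF G c, (arcType hw hk hc2 hwc 0).1 \ Z.1 ⊆ (arcType hw hk hc2 hwc 0).1 \ Y.1 →
        ((univ.filter fun s : G => w s = 0) \ Z.1).card = m → blk c Z ≠ E := by
    intro Y hYB hYbd Z hZ hZ0 hblk
    exact blk_ne_of_subBalanced hw hk hc2 hwc h1 hm hX hBm hpotX'' hne
      (fun i hi => (card_fib_sdiff_le_of_sdiff_subset_of_lt hw hk hc2 hwc hZ hi).trans (hYbd i hi)) hZ0
      (fun P hP hP0 => hYB P (hZ hP) hP0) (hblk.trans hEdef)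
  have hE := hEof Ψ (fun P hP hP0 => mem_sdiff.mpr ⟨mem_filter.mpr ⟨mem_univ _, hP0⟩, (mem_sdiff.mp hP).2⟩)
    (fun i _ => (card_fib_sdiff_eq_of_rt_eq hw hk hc2 hwc h1 hm hΨ hg _).le)
  -- (ii) `ζ_b` from the three-across: `X_B` DOWN (sub-balanced linearisation), `X''` UP by its explicit face
  have hsmall : 2 * (((univ.filter fun s : G => w s = 0) \ Ψ.1).card - 1) < (univ.filter fun s : G => w s = 0).card := by omega
  have hlarge : 2 * ((univ.filter fun s : G => w s = 0).card - ((univ.filter fun s : G => w s = 0) \ Ψ.1).card - 1) <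
      (univ.filter fun s : G => w s = 0).card := by omega
  obtain ⟨hXbd, hXtop, hXB0⟩ := subBalanced_of_pureTie hw hk hk2 hc2 hwc hm1 hX hBF hBm
  have eDn := single_sub_normalForm_mem_of_subBalanced hw hk hc2 hwc h1 L htw hm E hrule X hXbd hXtop (hEof X hXB0 hXbd)
  have eUp := single_sub_normalForm_mem_of_face hw hk hc2 hwc L htw Qm (Φ := oflipCM c hc2 v (oflipCM c hc2 b X))
    (by rw [← eT₁, hd1X'']; omega) (by rw [← eT₁, hT1X'']; exact mem_image_of_mem _ hu) (by rw [← eT₁, hT1X'']; exact mem_image_of_mem _ hu')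
    (fun h => huu' (mul_left_cancel h)) (by rw [← hfUpeq]; exact hL _ hUpS)
  rw [← eT₁] at eUp
  have hζb := zeta_mem_of_threeAcross_even_up hw hk hc2 hwc h1 L htw hb hX' hBF hsmall hlarge hv0 hvB (hL _ h3S) (by rw [hX'b]; exact eDn) eUp
  -- (iv) the interior unit shifts from the vertical faces (spectator ties DOWN)
  have hunit : ∀ j : ℕ, 1 ≤ j → j ≤ 2 ^ (k - 1) - 2 → ∃ u₀ : G, w u₀ = (j : ZMod (2 ^ k)) ∧
      (Finsupp.single (oflipCM c hc2 u₀ (arcType hw hk hc2 hwc 0)) (1 : ℤ) - Finsupp.single (arcType hw hk hc2 hwc 0) 1) -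
        (Finsupp.single (oflipCM c hc2 u₀ (arcType hw hk hc2 hwc 1)) (1 : ℤ) - Finsupp.single (arcType hw hk hc2 hwc 1) 1) ∈ L := by
    intro j hj1 hj2
    obtain ⟨-, hbd, htop, hB0⟩ := spectatorTie_spec hw hk hc2 hwc hX hBF hBm hm1 hj1 hj2 (hpt j)
    have hTT := mem_arcType_of_apply_eq_natCast hw hk hc2 hwc (hpt j) (by omega)
    have eZ := single_sub_normalForm_mem_of_subBalanced hw hk hc2 hwc h1 L htw hm E hrule (oflipCM c hc2 (pt j) X) hbd htop (hEof _ hB0 hbd)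
    exact ⟨pt j, hpt j, unitShift_mem_of_upperVertical hw hk hc2 hwc h1 L htw hX hBF hB2 (by omega) hv
      (by rw [hpt]; exact natCast_ne_zero_of_lt hj1 (by omega)) hTT.1 (hTT.2 hj1) (hL _ (hGsS j hj1 hj2)) eDn eZ⟩
  -- (iii) the relation of the owned face, with all unit shifts of the points of `T_0`
  have hR := rel_of_balancedFaceK hw hk hk2 hc2 hcen hwc h1 hm S₀ htw E hrule hΨ hg hE hs0 hsΨ ht'1 ht'Ψ (hL _ hΨS)
    (fun q hqT hq0 => unitShift_all_mem hw hk hk2 hc2 hcen hwc S₀ hunit hb0 hζb hqT hq0)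
  refine ⟨S₀, hS₀f, ?_, htw, ⟨b, hb0, hζb⟩, ⟨_, hBF, hR⟩, hunit⟩
  -- the count `|S₀| + 2 ≤ β`
  obtain ⟨n₀, n₁, hn₀1, hn₁1, hn₀₁, hn₀, hn₁⟩ := exists_two_ker hw (by omega)
  have hnear := half_add_one_le_card_filter_bpot_le_one' hw hk hc2 hcen hwc h1 hn₀1 hn₁1 hn₀₁ hn₀ hn₁
  have hsplit := card_filter_add_card_filter_not (s := (univ : Finset (Block c))) (fun Bk : Block c => 2 ≤ bpot c (arcType hw hk hc2 hwc 0) Bk.out)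
  have hneg : (univ.filter fun Bk : Block c => ¬ 2 ≤ bpot c (arcType hw hk hc2 hwc 0) Bk.out) = univ.filter fun Bk : Block c => bpot c (arcType hw hk hc2 hwc 0) Bk.out ≤ 1 :=
    filter_congr fun Bk _ => by omega
  rw [hneg, card_univ] at hsplit
  -- the far blocks split into interval-tie blocks and the others; `blk Ψ` is a far block of neither kind in the cover set
  have hsplit2 := card_filter_add_card_filter_not (s := univ.filter fun Bk : Block c => 2 ≤ bpot c (arcType hw hk hc2 hwc 0) Bk.out) tie
  have htiesub : (univ.filter fun Bk : Block c => tie Bk) ⊆ (univ.filter fun Bk : Block c => 2 ≤ bpot c (arcType hw hk hc2 hwc 0) Bk.out).filter tie := by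
    intro Bk hBk; rw [mem_filter] at hBk ⊢; exact ⟨mem_filter.mpr ⟨mem_univ _, ((htie Bk).mp hBk.2).1⟩, hBk.2⟩
  have hΨfar : blk c Ψ ∈ (univ.filter fun Bk : Block c => 2 ≤ bpot c (arcType hw hk hc2 hwc 0) Bk.out).filter (fun Bk => ¬ tie Bk) := by
    rw [mem_filter, mem_filter, bpot_out]
    refine ⟨⟨mem_univ _, hpotΨ2⟩, fun h => ?_⟩
    obtain ⟨-, Q, r, hr, hQ⟩ := (htie _).mp h
    exact not_intDatum_of_equidistant hw hk hc2 hwc h1 (fun P => bpot_eq_ddist_of_blk_eq_balanced hw hk hc2 hwc h1 hm hΨ hg (blk_out c _) P) hr hQ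
  have hgen_sub : insert (blk c Ψ) (univ.filter fun Bk : Block c => 2 ≤ bpot c (arcType hw hk hc2 hwc 0) Bk.out ∧ ¬ tie Bk ∧ Bk ≠ blk c Ψ) ⊆
      (univ.filter fun Bk : Block c => 2 ≤ bpot c (arcType hw hk hc2 hwc 0) Bk.out).filter (fun Bk => ¬ tie Bk) := by
    refine insert_subset hΨfar fun Bk hBk => ?_
    rw [mem_filter] at hBk; rw [mem_filter, mem_filter]; exact ⟨⟨mem_univ _, hBk.2.1⟩, hBk.2.2.1⟩
  have hΨnot : blk c Ψ ∉ univ.filter fun Bk : Block c => 2 ≤ bpot c (arcType hw hk hc2 hwc 0) Bk.out ∧ ¬ tie Bk ∧ Bk ≠ blk c Ψ := by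
    rw [mem_filter]; exact fun h => h.2.2.2 rfl
  have hgen_card := card_le_card hgen_sub
  rw [card_insert_of_notMem hΨnot] at hgen_card
  -- `E = blk X''` is an interval-tie block
  have hEtie : tie E := by
    obtain ⟨P, hP⟩ := exists_rt_eq_of_blk_eq c ((blk_out c E).trans hEdef)
    have hinv : rt c P⁻¹ (oflipCM c hc2 v (oflipCM c hc2 b X)) = E.out := by rw [← hP, rt_inv_rt]
    have hpot : bpot c (arcType hw hk hc2 hwc 0) E.out = m := by rw [← hinv, bpot_rt, hpotX'']
    have hdat := intDatum_rt hw hk hc2 hwc P⁻¹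
      (intDatum_of_pureTie hw hk hk2 hc2 hwc h1 (hX''.symm ▸ hCv) h2X'' (by rw [hX'']; exact insert_nonempty _ _))
    rw [hinv] at hdat
    exact (htie E).mpr ⟨by rw [hpot]; exact hm2, _, 1, by omega, hdat⟩
  have hEmem : E ∈ univ.filter fun Bk : Block c => tie Bk := mem_filter.mpr ⟨mem_univ _, hEtie⟩
  have htieE : (univ.filter fun Bk : Block c => tie Bk ∧ Bk ≠ E) = (univ.filter fun Bk : Block c => tie Bk).erase E := by
    ext Bk; simp only [mem_filter, mem_univ, true_and, mem_erase]; tauto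
  have htiec := card_erase_add_one hEmem
  rw [← htieE] at htiec
  have htiesub' := card_le_card htiesub
  have h3 : ({gface c hc2 (oflipCM c hc2 v (oflipCM c hc2 b X)) u u', gface c hc2 Ψ s t', gface c hc2 (oflipCM c hc2 b X) b v} :
      Finset (CMF G c →₀ ℤ)).card ≤ 3 := card_le_three
  have hG : Gs.card ≤ 2 ^ (k - 1) - 2 := by rw [hGs]; exact card_image_le.trans (by rw [Nat.card_Icc]; omega)
  have hun := card_union_le ((Sc ∪ St) ∪ {gface c hc2 (oflipCM c hc2 v (oflipCM c hc2 b X)) u u', gface c hc2 Ψ s t',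
    gface c hc2 (oflipCM c hc2 b X) b v}) Gs
  have hun1 := card_union_le (Sc ∪ St) ({gface c hc2 (oflipCM c hc2 v (oflipCM c hc2 b X)) u u', gface c hc2 Ψ s t',
    gface c hc2 (oflipCM c hc2 b X) b v} : Finset (CMF G c →₀ ℤ))
  have hun2 := card_union_le Sc St
  rw [← hS₀] at hun
  rw [hScc] at hun2
  omega

end

end Summit.HodgeConjecture.CorCM.Census.CyclicCharacter
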